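import Summits.QuantumFields.YangMills.Theorems.LangevinControlUVFemtoCurvatureTwoPointCDefsCore

/-!
# Route `LangevinControlUV`, crux `FemtoCurvatureTwoPointC` (stmt-QuantumFields-16204): vocabulary of line `Sketch`, V — the explicit two-loop form, interior separations

Part V of the route-posited statements of the skeleton `Cruxes/FemtoCurvatureTwoPointC/Lines/Sketch.lean` (continuation lead
`prover-line-stmt-QuantumFields-16204-c4-0`, cycle 6; parts I–IV are `…CDefs`, `…CDefsProfiles`, `…CDefsSplit` (+ `…CDefsScalingBig`),
`…CDefsCore`, same namespace: NOTHING here is asserted). `AsymptoticScalingCoreAt r` is to `AFProfilesCoreAt r` (part IV, reshape v6)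
what `AsymptoticScalingBigAt r` (`…CDefsScalingBig`) is to `AFProfilesBigAt r`: the SAME matching clauses — transverse lower and upper
(`1 ≤ n`, `8n ≤ L`), longitudinal upper (`1 ≤ s`, `8s ≤ L`), variance ceiling, on window boxes `L ≥ 8` — with the existential admissible
coupling `u` INSTANTIATED by the explicit two-loop asymptotic-freedom coupling `u = twoLoopCoupling κ c₀ b₀ q` (`…CDefs`), whose
admissibility (p124718), comparability / dyadic step law (p124768) and bare size (p128233) are landed calculus; hence
`AsymptoticScalingCoreAt r → AFProfilesCoreAt r` (companion file `…CScalingCoreReduction`). It is `AsymptoticScalingBigAt r` with the two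
upper profile ranges cut from `2s ≤ L` to `8s ≤ L` (reflection positivity supplies the top of the box, `…CCoreBridge`). Offered to the
planner as the CONCRETE (∃-over-parameters only) form of the promoted femto-engine statement: "two-sided asymptotic scaling of the diagonal
curvature profiles in two-loop units on femto boxes, at separations ≤ L/8".
-/

set_option autoImplicit false

noncomputable section

open Filter Topology MeasureTheory
open Literature.MathematicalPhysics.QuantumFieldTheory

namespace Summit.QuantumFields.YangMills.Theorems.FemtoCurvatureTwoPointC

/-- **Asymptotic scaling of the diagonal profiles on femto boxes, interior separations, at fixed data `(G, r)` (OPEN; crux-sized).**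
There are two-loop parameters `κ > 0`, `c₀`, `b₀ > 0`, `q ≥ 0`, a window height `u₀ > 0` with `u₀·ψ_q(2b₀ log 2) < 1`, a threshold `β₀`
and constants `0 < c`, `C` such that, `u` denoting the explicit two-loop coupling (`T = twoLoopT κ c₀ b₀ q`, `u L β = (twoLoopPsi q (T L β))⁻¹`,
written out), on every BOX `L ≥ 8` in the `u`-window at `β ≥ β₀` (every sub-box `8 ≤ M ≤ L` has `u M β ≤ u₀`): TRANSVERSE LOWER
`c·u(8n,β)² ≤ n⁸ f_L(n)` and TRANSVERSE UPPER `n⁸ f_L(n) ≤ C·u(8n,β)²` (`1 ≤ n`, `8n ≤ L`), LONGITUDINAL UPPER `s⁸ |g_L(s)| ≤ C·u(8s,β)²`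
(`1 ≤ s`, `8s ≤ L`), VARIANCE CEILING `Var_{L,β}(P_0^{01}) ≤ C·u(8,β)²` — with `f_L(s) = Cov_{L,β}(P_0^{01},P_{se₂}^{01})`,
`g_L(s) = Cov_{L,β}(P_0^{01},P_{se₀}^{01})`. Same `P`, `E` equations as everywhere in this vocabulary. -/
def AsymptoticScalingCoreAt {G : Type} [Group G] [TopologicalSpace G] [IsTopologicalGroup G] [CompactSpace G]
    [MeasurableSpace G] [BorelSpace G] (r : LatticeRep G) : Prop :=
  ∃ (κ c₀ b₀ q u₀ β₀ c C : ℝ),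
    0 < κ ∧ 0 < b₀ ∧ 0 ≤ q ∧ 0 < u₀ ∧
    u₀ * (1 + 2 * b₀ * Real.log 2 + q * Real.log (2 * b₀ * Real.log 2 + Real.exp 1)) < 1 ∧ 0 < c ∧
    ∀ (T u : ℕ → ℝ → ℝ),
      (T = fun (L : ℕ) (β : ℝ) => max (κ * β + c₀) 1 - q * Real.log (max (κ * β + c₀) 1 + q) -
          2 * b₀ * Real.log ((L : ℝ) / 8)) →
      (u = fun (L : ℕ) (β : ℝ) => ((1 + q) * Real.exp (min (T L β) 0) + max (T L β) 0 +
          q * (Real.log (max (T L β) 0 + Real.exp 1) - 1))⁻¹) →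
      (∀ (L : ℕ) [NeZero L] (β : ℝ) (n : ℕ), β₀ ≤ β → 1 ≤ n → 8 * n ≤ L →
          (∀ M : ℕ, 8 ≤ M → M ≤ L → u M β ≤ u₀) →
          ∀ (P : (Fin 4 → ZMod L) → Fin 4 → Fin 4 → GaugeConfig 4 L G → ℝ)
            (E : (GaugeConfig 4 L G → ℝ) → ℝ),
            (P = fun x i j U => (r.N : ℝ) - (r.ρ (plaquetteHolonomy U x i j)).trace.re) →
            (E = fun F => wilsonExpectation r.ρ β F) →
            c * u (8 * n) β ^ 2 ≤
              (n : ℝ) ^ 8 * (E (fun U => P 0 0 1 U * P (Pi.single (2 : Fin 4) ((n : ℕ) : ZMod L)) 0 1 U)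
                - E (P 0 0 1) * E (P (Pi.single (2 : Fin 4) ((n : ℕ) : ZMod L)) 0 1))) ∧
      (∀ (L : ℕ) [NeZero L] (β : ℝ) (s : ℕ), β₀ ≤ β → 8 ≤ L → 1 ≤ s → 8 * s ≤ L →
          (∀ M : ℕ, 8 ≤ M → M ≤ L → u M β ≤ u₀) →
          ∀ (P : (Fin 4 → ZMod L) → Fin 4 → Fin 4 → GaugeConfig 4 L G → ℝ)
            (E : (GaugeConfig 4 L G → ℝ) → ℝ),
            (P = fun x i j U => (r.N : ℝ) - (r.ρ (plaquetteHolonomy U x i j)).trace.re) →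
            (E = fun F => wilsonExpectation r.ρ β F) →
            (s : ℝ) ^ 8 * (E (fun U => P 0 0 1 U * P (Pi.single (2 : Fin 4) ((s : ℕ) : ZMod L)) 0 1 U)
                - E (P 0 0 1) * E (P (Pi.single (2 : Fin 4) ((s : ℕ) : ZMod L)) 0 1)) ≤
              C * u (8 * s) β ^ 2) ∧
      (∀ (L : ℕ) [NeZero L] (β : ℝ) (s : ℕ), β₀ ≤ β → 8 ≤ L → 1 ≤ s → 8 * s ≤ L →
          (∀ M : ℕ, 8 ≤ M → M ≤ L → u M β ≤ u₀) →
          ∀ (P : (Fin 4 → ZMod L) → Fin 4 → Fin 4 → GaugeConfig 4 L G → ℝ)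
            (E : (GaugeConfig 4 L G → ℝ) → ℝ),
            (P = fun x i j U => (r.N : ℝ) - (r.ρ (plaquetteHolonomy U x i j)).trace.re) →
            (E = fun F => wilsonExpectation r.ρ β F) →
            (s : ℝ) ^ 8 * |E (fun U => P 0 0 1 U * P (Pi.single (0 : Fin 4) ((s : ℕ) : ZMod L)) 0 1 U)
                - E (P 0 0 1) * E (P (Pi.single (0 : Fin 4) ((s : ℕ) : ZMod L)) 0 1)| ≤
              C * u (8 * s) β ^ 2) ∧
      (∀ (L : ℕ) [NeZero L] (β : ℝ), β₀ ≤ β → 8 ≤ L → (∀ M : ℕ, 8 ≤ M → M ≤ L → u M β ≤ u₀) →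
          ∀ (P : (Fin 4 → ZMod L) → Fin 4 → Fin 4 → GaugeConfig 4 L G → ℝ)
            (E : (GaugeConfig 4 L G → ℝ) → ℝ),
            (P = fun x i j U => (r.N : ℝ) - (r.ρ (plaquetteHolonomy U x i j)).trace.re) →
            (E = fun F => wilsonExpectation r.ρ β F) →
            E (fun U => P 0 0 1 U * P 0 0 1 U) - E (P 0 0 1) * E (P 0 0 1) ≤ C * u 8 β ^ 2)

/-- **Asymptotic scaling on femto boxes, interior separations (universal closure)**: for every compact simple `G` (any Borel structure)
and faithful unitary `r`, `AsymptoticScalingCoreAt r`. OPEN; a sufficient, explicit form of `AFProfilesCore`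
(`afProfilesCore_of_asymptoticScalingCore`, companion file). -/
def AsymptoticScalingCore : Prop :=
  ∀ (G : Type) [Group G] [TopologicalSpace G] [IsTopologicalGroup G] [CompactSpace G]
    [MeasurableSpace G] [BorelSpace G], IsCompactSimpleLieGroup G →
    ∀ r : LatticeRep G, AsymptoticScalingCoreAt r

/-- `AsymptoticScalingCore` unfolded (definitional; registered sub-goal linking the vocabulary file to the crux item). -/
theorem asymptoticScalingCore_iff :
    AsymptoticScalingCore ↔
      ∀ (G : Type) [Group G] [TopologicalSpace G] [IsTopologicalGroup G] [CompactSpace G]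
        [MeasurableSpace G] [BorelSpace G], IsCompactSimpleLieGroup G →
        ∀ r : LatticeRep G, AsymptoticScalingCoreAt r :=
  Iff.rfl

end Summit.QuantumFields.YangMills.Theorems.FemtoCurvatureTwoPointC

end
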